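import Literature.Geometry.Hyperkaehler.IsotropyAlgebraAction
import Mathlib.Analysis.Calculus.MeanValue
import Mathlib.Analysis.SpecialFunctions.Trigonometric.Inverse
import HarnessLib

/-!
# From the isotropy algebra `𝔤_M = 𝔰𝔲(2)` to the isotropy group `G_M = SU(2)`: `ad L β = 0` integrates to
# invariance under the circle of `L`, and `𝔤_M`-trivial covectors are exactly the `SU(2)`-invariant ones
# (Verbitsky 1996 §1, Prop. 1.1 / Prop. 1.2), pointwise, all degrees

Topic `Literature/Geometry/Hyperkaehler` (§2, namespace `Literature.Geometry.Hyperkaehler.IsLinearHyperkaehler`, carrier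
`IsLinearHyperkaehler g₀ J`) with a general §1 in namespace `Literature.LinearAlgebra.Alternating` (any real normed `E`,
`W`, any `L` with `L² = −1`). Lane `lit-hodgefound` (Track 2 foundations library), prover seat p06 (generation 14),
self-proposed row g14-#4; closes scope note (i) of row g14-#1 FILE 2 (`IsotropyAlgebraAction.lean`: "the integration
of `𝔰𝔲(2)` to the group `SU(2)` (Prop. 1.1) is not formalised … so '`G_M`-invariant' is the infinitesimal
condition").

## Source, verbatim (M. Verbitsky, *Hyperholomorphic bundles over a hyperkähler manifold*, J. Alg. Geom. 5 (1996)
= alg-geom/9307008, §1; held `paper:arxiv-alg-geom_9307008` p0001 L128–L141, p0002 L36–L50)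

"Therefore, the operators `ad I, ad J, ad K` generate a Lie algebra `𝔰𝔲(2)` acting on the bundle of differential
forms. We can integrate this Lie algebra action to the action of a Lie group `SU(2)`. In particular, operators
`I`, `J` and `K`, which act on differential forms by the formula `I(α∧β) = I(α)∧I(β)`, belong to this group.
Proposition 1.1: There is an action of the Lie group `SU(2)` and Lie algebra `𝔰𝔲(2)` on the bundle of
differential forms over a hyperkähler manifold. […]" — Prop. 1.2: "The form `ω` is `G_M`-invariant if and only if
it is of Hodge type `(p,p)` with respect to all induced complex structures on `M`. Proof: Assume that `ω` is
`G_M`-invariant. This implies that all elements of `𝔤_M` act trivially on `ω` […] `𝔤_M` is generated by such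
`ad L`, and therefore `𝔤_M` and `G_M` act trivially on `ω`."

## What is formalised (theorems only; no definition, no named fact, no `sorry`)

The group acts on `k`-covectors by pull-back `g^*β = β(g·, …, g·)` (Mathlib's `compContinuousLinearMap`, so that
"`I(α∧β) = I(α)∧I(β)`"); `ad` is its differential at the identity (FILE 1 `hasFDerivAt_compContinuousLinearMap`).

§1 (`L² = −1` on any real normed `E`, any values `W`, any degree): `fderivCompContinuousLinearMap_comp` (the
derivative of `g ↦ g^*β` in the direction `L∘g` is `g^*(ad L β)`); **`hasDerivAt_compContinuousLinearMap_circle`**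
(`θ ↦ (cos θ + sin θ L)^*β` has derivative `(cos θ + sin θ L)^*(ad L β)`); **`compContinuousLinearMap_circle_eq_self_of_adAlt_eq_zero`**
(`ad L β = 0` ⟹ `(cos θ + sin θ L)^*β = β` for all `θ`: the infinitesimal invariance INTEGRATES along the
one-parameter group `e^{θL} = cos θ + sin θ L`, by the mean value theorem `is_const_of_deriv_eq_zero`);
`compContinuousLinearMap_eq_self_of_adAlt_eq_zero` (`θ = π/2`: `L^*β = β` — "operators `I`, `J` and `K` … belong to
this group", now for every `L` and every degree, superseding FILE 1's `ℂ`-valued `I`-only version);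
`eq_zero_of_adAlt_eq_zero_of_odd` (`θ = π`: odd-degree `ad L`-trivial covectors vanish, any `W`); and the converse
**`adAlt_eq_zero_of_forall_compContinuousLinearMap_circle_eq_self`** (differentiate at `θ = 0`).
§2 (quaternionic Hermitian carrier): every unit quaternion `q = a + bI + cJ + dK` is `cos θ + sin θ λ_x` on the
circle of a unit twistor operator, so **`compContinuousLinearMap_quaternion_eq_self`** (`ad I β = 0 ∧ ad J β = 0` ⟹
`q^*β = β` for all unit `q`), **`adAlt_eq_zero_of_forall_compContinuousLinearMap_quaternion`** (conversely), packaged as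
**`forall_compContinuousLinearMap_quaternion_iff`**: `β` is `G_M = SU(2)`-invariant iff it is `𝔤_M`-trivial — in
degree `2` this is `Hyperholomorphic.lean`'s `isSU2InvariantAt_iff_quaternion` through FILE 2's
`isSU2InvariantAt_iff_adAlt`; `compContinuousLinearMap_twistorOp_eq_self` (`λ_x^*β = β` for unit `x`),
`eq_zero_of_adAlt_opI_eq_zero_of_odd'` (no odd invariants, any `W`).

SCOPE NOTE. Pointwise; "the action is parallel, and therefore it commutes with Laplace operator" (the rest of
Prop. 1.1) is not touched. The group here is the concrete `SU(2) = Sp(1)` of unit quaternions acting diagonally on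
`T_x M` (as in `Hyperholomorphic.lean`'s `quaternionAct`), which is Verbitsky's `G_M`.

## References

* [Verbitsky1996Hyperholomorphic] M. Verbitsky, J. Alg. Geom. 5 (1996) 633–669 = alg-geom/9307008, §1 (the
  `𝔰𝔲(2)`/`SU(2)` action, Prop. 1.1, Prop. 1.2 with proof).
* [Verbitsky1995Trianalytic] M. Verbitsky, GAFA 5 (1995) 92–104 = alg-geom/9403006, §1 (same text).
-/

noncomputable section

open scoped Matrix
open Function Finset Literature.LinearAlgebra.Alternating

/-! ## §1 `ad L β = 0` integrates to invariance under the circle `cos θ + sin θ · L` (`L² = −1`) -/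

namespace Literature.LinearAlgebra.Alternating

variable {E W : Type*} [NormedAddCommGroup E] [NormedSpace ℝ E] [NormedAddCommGroup W] [NormedSpace ℝ W]
  {k : ℕ}

/-- The derivative of the pull-back `g ↦ g^*β` in the direction `L ∘ g` is `g^*(ad L β)`.
[cite: Verbitsky1996Hyperholomorphic, §1 (Prop. 1.1: integrating the Lie algebra action)] -/
theorem fderivCompContinuousLinearMap_comp (β : E [⋀^Fin k]→L[ℝ] W) (g L : E →L[ℝ] E) :
    β.fderivCompContinuousLinearMap g (L.comp g) = (adAlt L β).compContinuousLinearMap g := by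
  ext v
  rw [ContinuousAlternatingMap.fderivCompContinuousLinearMap_apply, ContinuousAlternatingMap.compContinuousLinearMap_apply,
    adAlt_apply]
  refine Finset.sum_congr rfl fun i _ ↦ congrArg β (funext fun j ↦ ?_)
  by_cases h : j = i
  · subst h
    simp
  · simp [h]

/-- **The circle generated by `L`**: for `L² = −1` the curve `θ ↦ β ∘ (cos θ · 1 + sin θ · L)` has derivative
`(ad L β) ∘ (cos θ · 1 + sin θ · L)` (the curve is the one-parameter group `e^{θL}` and `ad L` is the differential of
the pull-back action, FILE 1 `hasFDerivAt_compContinuousLinearMap`).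
[cite: Verbitsky1996Hyperholomorphic, §1 (Prop. 1.1: "We can integrate this Lie algebra action to the action of a Lie group")] -/
theorem hasDerivAt_compContinuousLinearMap_circle (β : E [⋀^Fin k]→L[ℝ] W) {L : E →L[ℝ] E}
    (hL : ∀ v, L (L v) = -v) (θ : ℝ) :
    HasDerivAt (fun θ : ℝ ↦ β.compContinuousLinearMap (Real.cos θ • ContinuousLinearMap.id ℝ E + Real.sin θ • L))
      ((adAlt L β).compContinuousLinearMap (Real.cos θ • ContinuousLinearMap.id ℝ E + Real.sin θ • L)) θ := by
  -- the curve `g` and its derivative `L ∘ g`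
  have hg : HasDerivAt (fun θ : ℝ ↦ Real.cos θ • ContinuousLinearMap.id ℝ E + Real.sin θ • L)
      (L.comp (Real.cos θ • ContinuousLinearMap.id ℝ E + Real.sin θ • L)) θ := by
    have h := ((Real.hasDerivAt_cos θ).smul_const (ContinuousLinearMap.id ℝ E)).add
      ((Real.hasDerivAt_sin θ).smul_const L)
    have hLg : L.comp (Real.cos θ • ContinuousLinearMap.id ℝ E + Real.sin θ • L) =
        -Real.sin θ • ContinuousLinearMap.id ℝ E + Real.cos θ • L := by
      ext v
      simp only [ContinuousLinearMap.comp_apply, add_apply, smul_apply, ContinuousLinearMap.id_apply, map_add,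
        map_smul, hL]
      module
    rw [hLg]
    exact h
  have H := ((hasFDerivAt_const β θ).continuousAlternatingMapCompContinuousLinearMap hg.hasFDerivAt).hasDerivAt
  simp only [add_apply, ContinuousLinearMap.comp_apply, zero_apply, map_zero, zero_add,
    ContinuousLinearMap.toSpanSingleton_apply, one_smul, fderivCompContinuousLinearMap_comp] at H
  exact H

/-- **`ad L β = 0` ⟹ `β` is invariant under the whole circle `cos θ · 1 + sin θ · L`** (`L² = −1`, any degree, any
values): the infinitesimal invariance integrates ("We can integrate this Lie algebra action to the action of a Lie
group … In particular, operators `I`, `J` and `K` … belong to this group"). [cite: Verbitsky1996Hyperholomorphic, §1 (before Prop. 1.1)] -/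
theorem compContinuousLinearMap_circle_eq_self_of_adAlt_eq_zero {β : E [⋀^Fin k]→L[ℝ] W} {L : E →L[ℝ] E}
    (hL : ∀ v, L (L v) = -v) (h : adAlt L β = 0) (θ : ℝ) :
    β.compContinuousLinearMap (Real.cos θ • ContinuousLinearMap.id ℝ E + Real.sin θ • L) = β := by
  have hd : ∀ θ : ℝ, HasDerivAt
      (fun θ : ℝ ↦ β.compContinuousLinearMap (Real.cos θ • ContinuousLinearMap.id ℝ E + Real.sin θ • L)) 0 θ := by
    intro θ
    have H := hasDerivAt_compContinuousLinearMap_circle β hL θ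
    have h0 : (adAlt L β).compContinuousLinearMap (Real.cos θ • ContinuousLinearMap.id ℝ E + Real.sin θ • L) = 0 := by
      rw [h]
      ext v
      simp [ContinuousAlternatingMap.compContinuousLinearMap_apply]
    rwa [h0] at H
  have hconst := is_const_of_deriv_eq_zero (fun θ ↦ (hd θ).differentiableAt) (fun θ ↦ (hd θ).deriv) θ 0
  rw [hconst]
  ext v
  simp [ContinuousAlternatingMap.compContinuousLinearMap_apply]

/-- In particular `ad L β = 0` ⟹ `β(L·, …, L·) = β` (`θ = π/2`).
[cite: Verbitsky1996Hyperholomorphic, §1 ("operators I, J and K … belong to this group")] -/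
theorem compContinuousLinearMap_eq_self_of_adAlt_eq_zero {β : E [⋀^Fin k]→L[ℝ] W} {L : E →L[ℝ] E}
    (hL : ∀ v, L (L v) = -v) (h : adAlt L β = 0) : β.compContinuousLinearMap L = β := by
  have e := compContinuousLinearMap_circle_eq_self_of_adAlt_eq_zero hL h (Real.pi / 2)
  rwa [Real.cos_pi_div_two, Real.sin_pi_div_two, zero_smul, one_smul, zero_add] at e

/-- **Odd degree: `ad L β = 0` forces `β = 0`** (`θ = π`: `β = (−1)^*β = −β`).
[cite: Verbitsky1996Hyperholomorphic, §1 Prop. 1.2 (proof)] -/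
theorem eq_zero_of_adAlt_eq_zero_of_odd {β : E [⋀^Fin k]→L[ℝ] W} {L : E →L[ℝ] E} (hL : ∀ v, L (L v) = -v)
    (hk : Odd k) (h : adAlt L β = 0) : β = 0 := by
  have e := compContinuousLinearMap_circle_eq_self_of_adAlt_eq_zero hL h Real.pi
  rw [Real.cos_pi, Real.sin_pi, zero_smul, add_zero] at e
  have e' : ∀ v, -β v = β v := fun v ↦ by
    have hv := congrArg (fun γ : E [⋀^Fin k]→L[ℝ] W ↦ γ v) e
    simp only [ContinuousAlternatingMap.compContinuousLinearMap_apply] at hv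
    have hneg : (⇑((-1 : ℝ) • ContinuousLinearMap.id ℝ E) ∘ v) = fun i ↦ (-1 : ℝ) • v i := by
      funext i
      simp
    have hsm := β.toContinuousMultilinearMap.map_smul_univ (fun _ : Fin k ↦ (-1 : ℝ)) v
    rw [Finset.prod_const, Finset.card_univ, Fintype.card_fin, hk.neg_one_pow, neg_one_smul] at hsm
    change β (fun i ↦ (-1 : ℝ) • v i) = -β v at hsm
    rw [hneg, hsm] at hv
    exact hv
  ext v
  simp only [ContinuousAlternatingMap.coe_zero, Pi.zero_apply]
  have h2 : (2 : ℝ) • β v = 0 := by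
    rw [two_smul]
    nth_rewrite 1 [← e' v]
    exact neg_add_cancel _
  exact (smul_eq_zero.1 h2).resolve_left two_ne_zero

/-- Conversely, **invariance under the circle of `L` forces `ad L β = 0`** (differentiate at `θ = 0`).
[cite: Verbitsky1996Hyperholomorphic, §1 Prop. 1.2 (proof: "all elements of 𝔤_M act trivially on ω")] -/
theorem adAlt_eq_zero_of_forall_compContinuousLinearMap_circle_eq_self {β : E [⋀^Fin k]→L[ℝ] W} {L : E →L[ℝ] E}
    (hL : ∀ v, L (L v) = -v)
    (h : ∀ θ : ℝ, β.compContinuousLinearMap (Real.cos θ • ContinuousLinearMap.id ℝ E + Real.sin θ • L) = β) :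
    adAlt L β = 0 := by
  have H := hasDerivAt_compContinuousLinearMap_circle β hL 0
  have H0 : HasDerivAt
      (fun θ : ℝ ↦ β.compContinuousLinearMap (Real.cos θ • ContinuousLinearMap.id ℝ E + Real.sin θ • L)) 0 0 := by
    have : (fun θ : ℝ ↦ β.compContinuousLinearMap (Real.cos θ • ContinuousLinearMap.id ℝ E + Real.sin θ • L)) =
        fun _ ↦ β := funext h
    rw [this]
    exact hasDerivAt_const 0 β
  have e := H.unique H0
  rw [Real.cos_zero, Real.sin_zero, one_smul, zero_smul, add_zero] at e
  rw [← e]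
  ext v
  simp [ContinuousAlternatingMap.compContinuousLinearMap_apply]

end Literature.LinearAlgebra.Alternating

/-! ## §2 On a quaternionic Hermitian space: `𝔤_M`-trivial ⟺ `G_M = SU(2)`-invariant, all degrees -/

namespace Literature.Geometry.Hyperkaehler

namespace IsLinearHyperkaehler

open Complex

variable {E : Type*} [NormedAddCommGroup E] [NormedSpace ℂ E]
  {g₀ : E →L[ℝ] E →L[ℝ] ℝ} {J : E →L[ℝ] E}
  {W : Type*} [NormedAddCommGroup W] [NormedSpace ℝ W] {k : ℕ}

/-- **`𝔰𝔲(2)`-trivial covectors are invariant under every unit quaternion** `q = a + bI + cJ + dK`,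
`a² + b² + c² + d² = 1`, acting diagonally (`β(q·, …, q·) = β`), in every degree and for all values `W`: the
pointwise content of "The form `ω` is `G_M`-invariant … all elements of `𝔤_M` act trivially on `ω`", direction ⇐,
i.e. the integration of Prop. 1.1 (`q = cos θ + sin θ · λ_x` lies on the circle of the unit twistor operator
`λ_x`, `λ_x² = −1`, and `ad λ_x β = 0` by `adAlt_twistorOp_eq_zero`). [cite: Verbitsky1996Hyperholomorphic, §1 Prop. 1.1 and Prop. 1.2] -/
theorem compContinuousLinearMap_quaternion_eq_self (h : IsLinearHyperkaehler g₀ J) {β : E [⋀^Fin k]→L[ℝ] W}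
    (hI : adAlt (opI E) β = 0) (hJ : adAlt J β = 0) {a b c d : ℝ} (habcd : a ^ 2 + b ^ 2 + c ^ 2 + d ^ 2 = 1) :
    β.compContinuousLinearMap (a • ContinuousLinearMap.id ℝ E + b • opI E + c • J + d • opK J) = β := by
  -- `s = |(b, c, d)|`
  set s := Real.sqrt (b ^ 2 + c ^ 2 + d ^ 2) with hs
  have hs0 : 0 ≤ s := Real.sqrt_nonneg _
  have hs2 : s ^ 2 = b ^ 2 + c ^ 2 + d ^ 2 := Real.sq_sqrt (by positivity)
  by_cases hzero : b ^ 2 + c ^ 2 + d ^ 2 = 0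
  · -- `q = ±1`
    have hb : b = 0 := by nlinarith [sq_nonneg b, sq_nonneg c, sq_nonneg d]
    have hc : c = 0 := by nlinarith [sq_nonneg b, sq_nonneg c, sq_nonneg d]
    have hd : d = 0 := by nlinarith [sq_nonneg b, sq_nonneg c, sq_nonneg d]
    have ha : a ^ 2 = 1 := by nlinarith
    -- the circle of `I` at `θ` with `cos θ = a`, `sin θ = 0`
    have hII : ∀ v : E, opI E (opI E v) = -v := fun v ↦ by
      rw [opI_apply, opI_apply, smul_smul, I_mul_I, neg_one_smul]
    rcases sq_eq_one_iff.1 ha with rfl | rfl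
    · have e := compContinuousLinearMap_circle_eq_self_of_adAlt_eq_zero hII hI 0
      rw [Real.cos_zero, Real.sin_zero] at e
      rw [hb, hc, hd]
      simpa using e
    · have e := compContinuousLinearMap_circle_eq_self_of_adAlt_eq_zero hII hI Real.pi
      rw [Real.cos_pi, Real.sin_pi] at e
      rw [hb, hc, hd]
      simpa using e
  · -- `q = cos θ + sin θ · λ_x` with `x = (b, c, d)/s` a unit vector, `cos θ = a`, `sin θ = s`
    have hspos : 0 < s := lt_of_le_of_ne hs0 (fun h0 ↦ hzero (by rw [← hs2, ← h0]; ring))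
    set x : Fin 3 → ℝ := ![b / s, c / s, d / s] with hx
    have hxunit : x 0 ^ 2 + x 1 ^ 2 + x 2 ^ 2 = 1 := by
      simp only [hx, Matrix.cons_val_zero, Matrix.cons_val_one, Matrix.cons_val_two, Matrix.head_cons,
        Matrix.tail_cons]
      rw [div_pow, div_pow, div_pow, ← add_div, ← add_div, ← hs2, div_self (pow_ne_zero 2 hspos.ne')]
    have hLL := h.twistor_sq_eq_neg hxunit
    have had : adAlt (x 0 • opI E + x 1 • J + x 2 • opK J) β = 0 := h.adAlt_twistorOp_eq_zero hI hJ x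
    -- `θ = arccos a` has `cos θ = a`, `sin θ = s`
    have ha1 : a ^ 2 ≤ 1 := by nlinarith [sq_nonneg b, sq_nonneg c, sq_nonneg d]
    have hcos : Real.cos (Real.arccos a) = a :=
      Real.cos_arccos (by nlinarith [sq_nonneg a]) (by nlinarith [sq_nonneg a])
    have hsin : Real.sin (Real.arccos a) = s := by
      rw [Real.sin_arccos, hs]
      congr 1
      linarith
    have e := compContinuousLinearMap_circle_eq_self_of_adAlt_eq_zero hLL had (Real.arccos a)
    rw [hcos, hsin] at e
    have hb' : s * (b / s) = b := by field_simp
    have hc' : s * (c / s) = c := by field_simp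
    have hd' : s * (d / s) = d := by field_simp
    have hq : a • ContinuousLinearMap.id ℝ E + b • opI E + c • J + d • opK J =
        a • ContinuousLinearMap.id ℝ E + s • (x 0 • opI E + x 1 • J + x 2 • opK J) := by
      simp only [hx, Matrix.cons_val_zero, Matrix.cons_val_one, Matrix.cons_val_two, Matrix.head_cons,
        Matrix.tail_cons, smul_add, smul_smul, hb', hc', hd']
      abel
    rw [hq]
    exact e

/-- Conversely, **invariance under all unit quaternions forces `ad I β = 0 ∧ ad J β = 0`** (the circles of `I`
and of `J` are unit quaternions). [cite: Verbitsky1996Hyperholomorphic, §1 Prop. 1.2 (proof)] -/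
theorem adAlt_eq_zero_of_forall_compContinuousLinearMap_quaternion (h : IsLinearHyperkaehler g₀ J)
    {β : E [⋀^Fin k]→L[ℝ] W}
    (hq : ∀ a b c d : ℝ, a ^ 2 + b ^ 2 + c ^ 2 + d ^ 2 = 1 →
      β.compContinuousLinearMap (a • ContinuousLinearMap.id ℝ E + b • opI E + c • J + d • opK J) = β) :
    adAlt (opI E) β = 0 ∧ adAlt J β = 0 := by
  have hII : ∀ v : E, opI E (opI E v) = -v := fun v ↦ by
    rw [opI_apply, opI_apply, smul_smul, I_mul_I, neg_one_smul]
  refine ⟨adAlt_eq_zero_of_forall_compContinuousLinearMap_circle_eq_self hII fun θ ↦ ?_,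
    adAlt_eq_zero_of_forall_compContinuousLinearMap_circle_eq_self h.J_J fun θ ↦ ?_⟩
  · have e := hq (Real.cos θ) (Real.sin θ) 0 0 (by nlinarith [Real.cos_sq_add_sin_sq θ])
    simpa using e
  · have e := hq (Real.cos θ) 0 (Real.sin θ) 0 (by nlinarith [Real.cos_sq_add_sin_sq θ])
    simpa using e

/-- **Prop. 1.2 / Prop. 1.1 at the group level, all degrees**: a `k`-covector is invariant under the group
`G_M = SU(2)` of unit quaternions acting diagonally iff it is annihilated by the isotropy algebra `𝔤_M`
(`ad I β = 0 ∧ ad J β = 0`; by `forall_unit_adAlt_twistorOp_eq_zero_iff`, iff `ad L β = 0` for every induced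
complex structure `L`). In degree `2` this is `Hyperholomorphic.lean`'s `isSU2InvariantAt_iff_quaternion` read through
`isSU2InvariantAt_iff_adAlt`. [cite: Verbitsky1996Hyperholomorphic, §1 Prop. 1.1 and Prop. 1.2] -/
theorem forall_compContinuousLinearMap_quaternion_iff (h : IsLinearHyperkaehler g₀ J) {β : E [⋀^Fin k]→L[ℝ] W} :
    (∀ a b c d : ℝ, a ^ 2 + b ^ 2 + c ^ 2 + d ^ 2 = 1 →
      β.compContinuousLinearMap (a • ContinuousLinearMap.id ℝ E + b • opI E + c • J + d • opK J) = β) ↔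
      adAlt (opI E) β = 0 ∧ adAlt J β = 0 :=
  ⟨h.adAlt_eq_zero_of_forall_compContinuousLinearMap_quaternion,
    fun ⟨hI, hJ⟩ _ _ _ _ habcd ↦ h.compContinuousLinearMap_quaternion_eq_self hI hJ habcd⟩

/-- In particular an `𝔰𝔲(2)`-trivial covector is invariant under every UNIT twistor operator `λ_x`
(`β(λ_x·, …, λ_x·) = β`): the all-degree form of "of type `(p,p)` with respect to `L` ⟹ `L`-invariant".
[cite: Verbitsky1996Hyperholomorphic, §1 ("operators I, J and K … belong to this group")] -/
theorem compContinuousLinearMap_twistorOp_eq_self (h : IsLinearHyperkaehler g₀ J) {β : E [⋀^Fin k]→L[ℝ] W}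
    (hI : adAlt (opI E) β = 0) (hJ : adAlt J β = 0) {x : Fin 3 → ℝ} (hx : x 0 ^ 2 + x 1 ^ 2 + x 2 ^ 2 = 1) :
    β.compContinuousLinearMap (x 0 • opI E + x 1 • J + x 2 • opK J) = β :=
  compContinuousLinearMap_eq_self_of_adAlt_eq_zero (h.twistor_sq_eq_neg hx) (h.adAlt_twistorOp_eq_zero hI hJ x)

/-- **No odd-degree `𝔤_M`-invariants**, for arbitrary values `W` (FILE 2's `eq_zero_of_adAlt_opI_eq_zero_of_odd` needed
`ℂ`-values and the type decomposition). [cite: Verbitsky1996Hyperholomorphic, §1 Prop. 1.2 (proof)] -/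
theorem eq_zero_of_adAlt_opI_eq_zero_of_odd' {β : E [⋀^Fin k]→L[ℝ] W} (hk : Odd k) (hI : adAlt (opI E) β = 0) :
    β = 0 :=
  eq_zero_of_adAlt_eq_zero_of_odd (fun v ↦ by rw [opI_apply, opI_apply, smul_smul, I_mul_I, neg_one_smul]) hk hI

end IsLinearHyperkaehler

end Literature.Geometry.Hyperkaehler

end
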